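import Summits.QuantumFields.YangMills.Theorems.BalabanLadderNTStrongCouplingInfluence
import Summits.QuantumFields.YangMills.Theorems.BalabanLadderUVSeamRecCeilingsTorusDLRMeasurable
import Literature.Probability.LatticeModels.DobrushinShlosmanWindowDusting
import HarnessLib

/-!
# Route `SqueezedSkewness`, item `AntipodalMixing` (stmt-QuantumFields-23390): its SHAPE at strong coupling —
# sup-normalised antipodal mixing on the odd torus from Dobrushin's comparison theorem

The IR input of the LINE «Markov ceiling» (planner ym-idea-6 g11; crux `AntipodalMirrorCeiling` 23202, bears_on R2a /
stmt-QuantumFields-19353 via the route's `closes`) asks, at WEAK coupling and in physical units, that every bounded measurable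
observable reading only links near the slice site `x₀` decorrelate from its time reflection, UNIFORMLY over all such observables
(rate-free, sup-normalised).  This file proves that exact shape in the opposite regime, for every compact `G` and every lattice
representation: at `216 · N · |β| ≤ 1` (the every-group Dobrushin window of the Wilson specification),

* `abs_torusCov_le_of_kernel_osc` — **torus covariance from kernel oscillation** (any finite link set `Λ`, MEASURABLE bounded
  cylinder observables): if `H` reads no link of `Λ` and the DLR kernel mean `ω ↦ ∫ F dγ_Λ(·|ω)` oscillates by `≤ ε` over all
  exteriors, then `|Cov_T(H, F)| ≤ M_H · ε` (torus DLR equation in measurable form `DLRPeeling.integral_torusLift_eq_integral_kernel_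
  of_measurable`, properness `integral_ymSpecification_cyl_mul`, and `|g − ∫g| ≤ osc g`);
* `kernel_osc_ball` — for the ball of links of radius `m` around a site `y` and `F` reading links within distance `b` of `y`:
  `osc ≤ 2M · #Δ · 2^{−(m+1−b)}` (`StrongCoupling.abs_kerInt_sub_le_of_agree_ball`, agreement hypothesis vacuous);
* `abs_mirror_cov_le_strongCoupling`, `abs_mirror_cov_le_antipodal` — **`|Cov_T(F∘Θ₀, F)| ≤ M·2M·#Δ·2^{−(⌊T/4⌋ − 2b − 1)}`** for
  `F` local within `b` of `z₀ = (⌊T/4⌋, 0⃗)`, `T = 2L+1` (the ball of radius `⌊T/4⌋ − b − 2` misses the reflected support);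
* `antipodal_mixing_shape_strongCoupling` — the rate-free packaging: `∀ b η > 0 ∃ L₀ ∀ L ≥ L₀ ∀ β (216N|β| ≤ 1) ∀ F` measurable,
  `|F| ≤ 1`, local within `b` of `z₀`: `Cov_T(F∘Θ₀, F) ≤ η`.

Fleet lead `ym-spine-19353-p1` g19.  HONEST FRAMING: a strong-coupling (high-temperature) rung — the typed shape of item 23390
holds where Dobrushin uniqueness holds, with an exponential rate and uniformly over UV-sharp local observables; it says nothing
at weak coupling, where the item lives; no crux, NT statement, rung of record or mass gap is proved.
Refs: R. L. Dobrushin, Theory Probab. Appl. 15 (1970) 458; H.-O. Georgii (2011) Thm. 8.20, Rem. 8.26; K. Osterwalder,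
E. Seiler, Ann. Phys. 110 (1978) 440 §2. [folklore]
-/

set_option autoImplicit false

noncomputable section

open MeasureTheory Filter Topology
open Literature.MathematicalPhysics.QuantumFieldTheory Literature.MathematicalPhysics.QuantumLattice
open Literature.Probability.LatticeModels.DobrushinShlosman (measurable_windowAvg')
open Summit.QuantumFields.YangMills.Cruxes.OSLegsFromFemtoAndGap.DlrCollarTransfer
open Summit.QuantumFields.YangMills.Cruxes.OSLegsFromFemtoAndGap.DlrCollarTransfer.StubLower (mem_cubeSites_iff)
open Summit.QuantumFields.YangMills.Cruxes.UVSeamRec.DLRPeeling (integral_torusLift_eq_integral_kernel_of_measurable)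
open Summit.QuantumFields.YangMills.Cruxes.NT.StrongCoupling (abs_kerInt_sub_le_of_agree_ball)
open Summit.QuantumFields.YangMills.Cruxes.NT.BoundaryLaw (isSpecification_cubeKernels)
open Summit.QuantumFields.YangMills.Cruxes.NT.MarkovMirror (isCylinder_comp_cfgReflect reflect_window)

namespace Summit.QuantumFields.YangMills.Theorems.AntipodalMixingStrongCoupling

variable (G : Type) [Group G] [TopologicalSpace G] [IsTopologicalGroup G] [CompactSpace G]
  [MeasurableSpace G] [BorelSpace G] (r : LatticeRep G)

/-! ## §1 Torus covariance from the oscillation of a DLR kernel mean -/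

/-- **Covariance from kernel oscillation.**  On the torus of side `2L+1` let `F`, `H` be bounded measurable cylinder
observables of `ℤ⁴` (read through the periodic lift), `Λ` a finite link set containing no link read by `H`, everything
inside one coordinate window; if the DLR kernel mean `ω ↦ ∫ F dγ_Λ(·|ω)` oscillates by at most `ε` over ALL exteriors, then
`|Cov_T(H, F)| ≤ M_H · ε`: the torus DLR equation for `H·F` and for `F` (tree, measurable form), properness of the kernel
(the exterior factor `H` pulls out), and `|g − ∫ g dμ_T| ≤ ε` for the kernel mean `g`. [folklore] -/
theorem abs_torusCov_le_of_kernel_osc (β : ℝ) (L : ℕ)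
    (Λ : Finset (Literature.MathematicalPhysics.QuantumLattice.ZdEdge 4)) {F H : LGConfig 4 G → ℝ}
    (hFm : Measurable F) (hHm : Measurable H) {MF MH : ℝ} (hMF : ∀ U, |F U| ≤ MF) (hMH : ∀ U, |H U| ≤ MH)
    {SF SH : Finset (Literature.MathematicalPhysics.QuantumLattice.ZdEdge 4)} (hFS : IsCylinder F SF)
    (hHS : IsCylinder H SH) (hSHoff : ∀ e ∈ SH, e ∉ Λ) (lo : Fin 4 → ℤ)
    (hwin : ∀ e ∈ Λ ∪ (SH ∪ SF), ∀ j, lo j + 1 ≤ e.1 j ∧ e.1 j + 2 ≤ lo j + (2 * L + 1 : ℕ)) {ε : ℝ}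
    (hosc : ∀ ω η : LGConfig 4 G, |(∫ V, F V ∂(ymSpecification (d := 4) r.ρ β Λ ω)) -
      ∫ V, F V ∂(ymSpecification (d := 4) r.ρ β Λ η)| ≤ ε) :
    |torusE G r β L (fun U => H U * F U) - torusE G r β L H * torusE G r β L F| ≤ MH * ε := by
  haveI := r.secondCountableTopology
  haveI := isProbabilityMeasure_wilsonMeasure (d := 4) (L := 2 * L + 1) r.ρ r.continuous β
  set T : ℕ := 2 * L + 1 with hT
  set μ : Measure (GaugeConfig 4 (2 * L + 1) G) := wilsonMeasure (d := 4) (L := 2 * L + 1) r.ρ β with hμ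
  set g : GaugeConfig 4 (2 * L + 1) G → ℝ := fun U => ∫ V, F V ∂(ymSpecification (d := 4) r.ρ β Λ (torusLift (2 * L + 1) U))
    with hg_def
  have hMH0 : 0 ≤ MH := (abs_nonneg _).trans (hMH fun _ => 1)
  have hε0 : 0 ≤ ε := (abs_nonneg _).trans (hosc (fun _ => 1) (fun _ => 1))
  -- DLR for `H · F` and properness
  have hHF : Measurable fun U => H U * F U := hHm.mul hFm
  have hHFb : ∀ U, |H U * F U| ≤ MH * MF := fun U => by
    rw [abs_mul]; exact mul_le_mul (hMH U) (hMF U) (abs_nonneg _) hMH0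
  have h1 : torusE G r β L (fun U => H U * F U) = ∫ U, H (torusLift T U) * g U ∂μ := by
    unfold torusE
    rw [integral_torusLift_eq_integral_kernel_of_measurable r.ρ r.continuous β Λ hHF hHFb
      (IsCylinder.mul hHS hFS) (2 * L + 1) lo hwin]
    refine integral_congr_ae (ae_of_all _ fun U => ?_)
    exact integral_ymSpecification_cyl_mul r.ρ r.continuous β Λ hFm hHm hHS hSHoff _
  have h2 : torusE G r β L F = ∫ U, g U ∂μ := by
    unfold torusE
    exact integral_torusLift_eq_integral_kernel_of_measurable r.ρ r.continuous β Λ hFm hMF hFS (2 * L + 1) lo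
      (fun e he j => hwin e (by
        rcases Finset.mem_union.1 he with h | h
        · exact Finset.mem_union_left _ h
        · exact Finset.mem_union_right _ (Finset.mem_union_right _ h)) j)
  -- measurability / bounds of the kernel mean
  have hγ := isSpecification_cubeKernels G r β
  have hgm : Measurable g :=
    (measurable_windowAvg' hγ Λ hFm).comp (continuous_torusLift (2 * L + 1)).measurable
  have hgb : ∀ U, |g U| ≤ MF := fun U => by
    haveI := isProbabilityMeasure_ymSpecification r.ρ r.continuous β Λ (torusLift (2 * L + 1) U)
    have h := norm_integral_le_of_norm_le_const (μ := ymSpecification (d := 4) r.ρ β Λ (torusLift (2 * L + 1) U))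
      (f := F) (C := MF) (ae_of_all _ fun V => by rw [Real.norm_eq_abs]; exact hMF V)
    simpa [hg_def] using h
  have hHt : Measurable fun U : GaugeConfig 4 (2 * L + 1) G => H (torusLift T U) :=
    hHm.comp (continuous_torusLift _).measurable
  have iH : Integrable (fun U => H (torusLift T U)) μ :=
    Integrable.of_bound hHt.aestronglyMeasurable MH (ae_of_all _ fun U => by rw [Real.norm_eq_abs]; exact hMH _)
  have ig : Integrable g μ :=
    Integrable.of_bound hgm.aestronglyMeasurable MF (ae_of_all _ fun U => by rw [Real.norm_eq_abs]; exact hgb _)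
  have iHg : Integrable (fun U => H (torusLift T U) * g U) μ :=
    Integrable.of_bound (hHt.mul hgm).aestronglyMeasurable (MH * MF) (ae_of_all _ fun U => by
      rw [Real.norm_eq_abs, abs_mul]; exact mul_le_mul (hMH _) (hgb _) (abs_nonneg _) hMH0)
  -- `|g U − ∫ g| ≤ ε`
  have hgc : ∀ U, |g U - ∫ U', g U' ∂μ| ≤ ε := by
    intro U
    have : g U - ∫ U', g U' ∂μ = ∫ U', (g U - g U') ∂μ := by
      rw [integral_sub (integrable_const _) ig, integral_const, probReal_univ, one_smul]
    rw [this]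
    have h := norm_integral_le_of_norm_le_const (μ := μ) (f := fun U' => g U - g U') (C := ε)
      (ae_of_all _ fun U' => by rw [Real.norm_eq_abs]; exact hosc _ _)
    simpa using h
  -- assemble
  rw [h1, h2]
  have e1 : (∫ U, H (torusLift T U) * g U ∂μ) - (∫ U, H (torusLift T U) ∂μ) * (∫ U, g U ∂μ) =
      ∫ U, H (torusLift T U) * (g U - ∫ U', g U' ∂μ) ∂μ := by
    have : (fun U => H (torusLift T U) * (g U - ∫ U', g U' ∂μ)) =
        fun U => H (torusLift T U) * g U - (∫ U', g U' ∂μ) * H (torusLift T U) := by funext U; ring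
    rw [this, integral_sub iHg (iH.const_mul _), integral_const_mul]
    ring
  unfold torusE at e1 ⊢
  rw [e1]
  have h := norm_integral_le_of_norm_le_const (μ := μ) (f := fun U => H (torusLift T U) * (g U - ∫ U', g U' ∂μ))
    (C := MH * ε) (ae_of_all _ fun U => by
      rw [Real.norm_eq_abs, abs_mul]; exact mul_le_mul (hMH _) (hgc U) (abs_nonneg _) hMH0)
  simpa using h

/-! ## §2 The ball of links around a site, and the strong-coupling oscillation of its kernel -/

/-- Integer sup-distance `⌊‖z − y‖_∞⌋ ≤ m` puts the link inside the ball of links of radius `m` around `y`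
(base points in the cube `[y − m, y + m]`). [folklore] -/
theorem mem_ball_of_floor_norm_le (y : Fin 4 → ℤ) (m : ℕ) (z : Literature.MathematicalPhysics.QuantumLattice.ZdEdge 4)
    (hz : ⌊‖z.1 - y‖⌋₊ ≤ m) : z ∈ cubeSites (fun j => y j - m) (2 * m + 1) ×ˢ (Finset.univ : Finset (Fin 4)) := by
  rw [Finset.mem_product, mem_cubeSites_iff]
  refine ⟨fun j => ?_, Finset.mem_univ _⟩
  have hlt : ‖z.1 - y‖ < (m : ℝ) + 1 := by
    have := (Nat.floor_lt (norm_nonneg _)).1 (Nat.lt_succ_of_le hz)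
    exact_mod_cast this
  have hj : ‖(z.1 - y) j‖ ≤ ‖z.1 - y‖ := norm_le_pi_norm _ j
  rw [Pi.sub_apply, Int.norm_eq_abs, Int.cast_sub] at hj
  have h2 : ((|z.1 j - y j| : ℤ) : ℝ) < (m : ℝ) + 1 := by push_cast; linarith
  have h3 : |z.1 j - y j| < (m : ℤ) + 1 := by exact_mod_cast h2
  have h4 := abs_lt.1 h3
  push_cast
  constructor <;> linarith [h4.1, h4.2]

/-- A coordinatewise window of half-width `b` around `y` bounds the integer sup-distance by `b`. [folklore] -/
theorem floor_norm_le_of_window (y : Fin 4 → ℤ) (b : ℕ) (z : Literature.MathematicalPhysics.QuantumLattice.ZdEdge 4)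
    (hz : ∀ j, |z.1 j - y j| ≤ b) : ⌊‖z.1 - y‖⌋₊ ≤ b := by
  have h1 : ‖z.1 - y‖ ≤ (b : ℝ) := by
    refine (pi_norm_le_iff_of_nonneg (Nat.cast_nonneg b)).2 fun j => ?_
    rw [Pi.sub_apply, Int.norm_eq_abs, Int.cast_sub]
    have h2 : ((|z.1 j - y j| : ℤ) : ℝ) ≤ (b : ℝ) := by exact_mod_cast hz j
    push_cast at h2
    exact h2
  calc ⌊‖z.1 - y‖⌋₊ ≤ ⌊(b : ℝ)⌋₊ := Nat.floor_mono h1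
    _ = b := Nat.floor_natCast b

/-- **Strong-coupling oscillation of the ball kernel.**  With `216 N |β| ≤ 1`, for the ball of links of radius `m`
around `y` and a bounded measurable observable `F` (`|F| ≤ M`) reading only links `Δ` within coordinate distance `b` of
`y`: for ALL exteriors `ω, η`, `|∫ F dγ_Λ(·|ω) − ∫ F dγ_Λ(·|η)| ≤ 2M · #Δ · 2^{−(m+1−b)}` (Dobrushin comparison with the ball
profile — `StrongCoupling.abs_kerInt_sub_le_of_agree_ball` — the agreement hypothesis being vacuous: every link within
distance `m` of `y` lies IN `Λ`). [folklore] -/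
theorem kernel_osc_ball {β : ℝ} (hβ : 216 * (r.N : ℝ) * |β| ≤ 1) (y : Fin 4 → ℤ) (m b : ℕ)
    {F : LGConfig 4 G → ℝ} (hFm : Measurable F) {M : ℝ} (hM : ∀ U, |F U| ≤ M)
    {Δ : Finset (Literature.MathematicalPhysics.QuantumLattice.ZdEdge 4)} (hFS : IsCylinder F Δ)
    (hΔ : ∀ z ∈ Δ, ∀ j, |z.1 j - y j| ≤ b) (ω η : LGConfig 4 G) :
    |(∫ V, F V ∂(ymSpecification (d := 4) r.ρ β (cubeSites (fun j => y j - m) (2 * m + 1) ×ˢ Finset.univ) ω)) -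
        ∫ V, F V ∂(ymSpecification (d := 4) r.ρ β (cubeSites (fun j => y j - m) (2 * m + 1) ×ˢ Finset.univ) η)| ≤
      2 * M * Δ.card * (1 / 2 : ℝ) ^ (m + 1 - b) :=
  abs_kerInt_sub_le_of_agree_ball G r hβ _ ω η y m
    (fun z hz hle => absurd (mem_ball_of_floor_norm_le y m z hle) hz) hFm hFS hM
    (fun z hz => floor_norm_le_of_window y b z (hΔ z hz))

/-! ## §3 The mirror covariance of a bounded measurable local observable at strong coupling -/

/-- **Mirror covariance at strong coupling (quantitative).**  `216 N |β| ≤ 1`; a bounded measurable observable `F`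
(`|F| ≤ M`) reading only links `Δ` within coordinate distance `b` of the site `y` of `ℤ⁴`; a ball radius `m ≥ b` with
`m + b + 1 ≤ 2·y₀` (the ball of radius `m` around `y` misses the time-reflected support) and the torus window conditions
`−L ≤ y_j − m`, `y_j + m ≤ L − 2`.  Then on the torus of side `2L+1`
`|Cov_T(F ∘ Θ₀, F)| ≤ M · 2M · #Δ · 2^{−(m+1−b)}`. [folklore] -/
theorem abs_mirror_cov_le_strongCoupling {β : ℝ} (hβ : 216 * (r.N : ℝ) * |β| ≤ 1) (L : ℕ) (y : Fin 4 → ℤ)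
    (m b : ℕ) (hbm : b ≤ m) (hsep : (m : ℤ) + b + 1 ≤ 2 * y 0) (hwin : ∀ j, -(L : ℤ) ≤ y j - m ∧ y j + m ≤ (L : ℤ) - 2)
    {F : LGConfig 4 G → ℝ} (hFm : Measurable F) {M : ℝ} (hM : ∀ U, |F U| ≤ M)
    {Δ : Finset (Literature.MathematicalPhysics.QuantumLattice.ZdEdge 4)} (hFS : IsCylinder F Δ)
    (hΔ : ∀ z ∈ Δ, ∀ j, |z.1 j - y j| ≤ b) :
    |torusE G r β L (fun U => F (cfgReflect U) * F U) - torusE G r β L (fun U => F (cfgReflect U)) * torusE G r β L F| ≤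
      M * (2 * M * Δ.card * (1 / 2 : ℝ) ^ (m + 1 - b)) := by
  classical
  haveI := r.secondCountableTopology
  -- the reflected observable: measurable, bounded, cylinder on the reflected links, off the ball, inside the window
  have hHm : Measurable fun U => F (cfgReflect U) := hFm.comp measurable_cfgReflect
  have hHS := isCylinder_comp_cfgReflect hFS
  have hΔ0 : ∀ e ∈ Δ, y 0 - b ≤ e.1 0 ∧ e.1 0 ≤ y 0 + b := fun e he => by
    have := abs_le.1 (hΔ e he 0); constructor <;> linarith [this.1, this.2]
  have hoff : ∀ e ∈ Δ.image reflectEdge, e ∉ cubeSites (fun j => y j - m) (2 * m + 1) ×ˢ (Finset.univ : Finset (Fin 4)) := by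
    intro e he hmem
    obtain ⟨-, h2, -⟩ := reflect_window hΔ0 he
    rw [Finset.mem_product, mem_cubeSites_iff] at hmem
    have := (hmem.1 0).1
    linarith
  refine abs_torusCov_le_of_kernel_osc G r β L _ hFm hHm hM (fun U => hM _) hFS hHS hoff (fun _ => -(L : ℤ) - 1)
    (fun e he j => ?_) (kernel_osc_ball G r hβ y m b hFm hM hFS hΔ)
  -- the window bookkeeping
  rcases Finset.mem_union.1 he with h1 | h23
  · rw [Finset.mem_product, mem_cubeSites_iff] at h1
    have := h1.1 j
    have hw := hwin j
    push_cast at this ⊢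
    constructor <;> linarith [this.1, this.2, hw.1, hw.2]
  · rcases Finset.mem_union.1 h23 with h2 | h3
    · obtain ⟨ht1, ht2, hsp⟩ := reflect_window hΔ0 h2
      by_cases hj : j = 0
      · subst hj
        have hy := hwin 0
        have hbm' : (b : ℤ) ≤ m := by exact_mod_cast hbm
        push_cast
        constructor <;> linarith [hy.1, hy.2]
      · obtain ⟨e', he', hee'⟩ := hsp j hj
        rw [hee']
        have := abs_le.1 (hΔ e' he' j)
        have hw := hwin j
        push_cast
        constructor <;> linarith [this.1, this.2, hw.1, hw.2]
    · have := abs_le.1 (hΔ e h3 j)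
      have hw := hwin j
      push_cast
      constructor <;> linarith [this.1, this.2, hw.1, hw.2]


/-! ## §4 Antipodal geometry: the mirror slice `⌊T/4⌋` of the odd torus, and the rate-free shape -/

/-- **Antipodal mirror covariance at strong coupling (quantitative).**  `216 N |β| ≤ 1`; the site
`z₀ = (⌊(2L+1)/4⌋, 0⃗)` with `2b + 2 ≤ ⌊(2L+1)/4⌋`; a bounded measurable `F` (`|F| ≤ M`) reading only links `Δ` within
coordinate distance `b` of `z₀`.  Then `|Cov_T(F ∘ Θ₀, F)| ≤ M · 2M · #Δ · 2^{−(⌊(2L+1)/4⌋ − 2b − 1)}` (ball radius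
`m = ⌊(2L+1)/4⌋ − b − 2`). [folklore] -/
theorem abs_mirror_cov_le_antipodal {β : ℝ} (hβ : 216 * (r.N : ℝ) * |β| ≤ 1) (L b : ℕ) (hL : 2 * b + 2 ≤ (2 * L + 1) / 4)
    {F : LGConfig 4 G → ℝ} (hFm : Measurable F) {M : ℝ} (hM : ∀ U, |F U| ≤ M)
    {Δ : Finset (Literature.MathematicalPhysics.QuantumLattice.ZdEdge 4)} (hFS : IsCylinder F Δ)
    (hΔ : ∀ z ∈ Δ, ∀ j, |z.1 j - (![(((2 * L + 1) / 4 : ℕ) : ℤ), 0, 0, 0] : Fin 4 → ℤ) j| ≤ b) :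
    |torusE G r β L (fun U => F (cfgReflect U) * F U) - torusE G r β L (fun U => F (cfgReflect U)) * torusE G r β L F| ≤
      M * (2 * M * Δ.card * (1 / 2 : ℝ) ^ ((2 * L + 1) / 4 - 2 * b - 1)) := by
  obtain ⟨h, hh⟩ : ∃ h : ℕ, h = (2 * L + 1) / 4 := ⟨_, rfl⟩
  rw [← hh] at hL hΔ ⊢
  have h4 : 4 * h ≤ 2 * L + 1 := by rw [hh]; exact Nat.mul_div_le (2 * L + 1) 4
  have key := abs_mirror_cov_le_strongCoupling G r hβ L (![(h : ℤ), 0, 0, 0]) (h - b - 2) b (by omega)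
    (by simp only [Matrix.cons_val_zero]; omega)
    (fun j => by fin_cases j <;> simp <;> omega) hFm hM hFS hΔ
  have hexp : h - b - 2 + 1 - b = h - 2 * b - 1 := by omega
  rw [hexp] at key
  exact key

/-- **The SHAPE of `AntipodalMixing` / `BoundaryResponseMixing` at strong coupling** (the IR item of the Markov-ceiling line,
stmt-QuantumFields-23390, in lattice units and `torusE`/`cfgReflect` vocabulary): for every lattice radius `b` and tolerance
`η > 0` there is `L₀` such that on every odd torus `2L+1`, `L ≥ L₀`, at every coupling with `216 N |β| ≤ 1`, EVERY bounded
measurable observable `|F| ≤ 1` reading only the links within coordinate distance `b` of the slice site `z₀ = (⌊(2L+1)/4⌋, 0⃗)`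
satisfies `Cov_T(F ∘ Θ₀, F) ≤ η` — uniformly over all such `F` (sup-normalised, rate-free as typed; the proof gives the
exponential rate `2 · 4(2b+1)⁴ · 2^{−(⌊(2L+1)/4⌋ − 2b − 1)}`), for every compact `G` and every lattice representation.
Strong coupling only: the opposite regime of the item. [folklore] -/
theorem antipodal_mixing_shape_strongCoupling (b : ℕ) {η : ℝ} (hη : 0 < η) :
    ∃ L₀ : ℕ, ∀ L : ℕ, L₀ ≤ L → ∀ β : ℝ, 216 * (r.N : ℝ) * |β| ≤ 1 →
      ∀ F : LGConfig 4 G → ℝ, Measurable F → (∀ U, |F U| ≤ 1) →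
        IsCylinder F (cubeSites (fun j => (![(((2 * L + 1) / 4 : ℕ) : ℤ), 0, 0, 0] : Fin 4 → ℤ) j - b) (2 * b + 1) ×ˢ
          (Finset.univ : Finset (Fin 4))) →
        torusE G r β L (fun U => F (cfgReflect U) * F U) - torusE G r β L (fun U => F (cfgReflect U)) * torusE G r β L F ≤ η := by
  -- the number of links within coordinate distance `b` of a site
  have hcard : ∀ c : Fin 4 → ℤ, (cubeSites c (2 * b + 1) ×ˢ (Finset.univ : Finset (Fin 4))).card = (2 * b + 1) ^ 4 * 4 := by
    intro c
    rw [Finset.card_product, Finset.card_univ, Fintype.card_fin]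
    congr 1
    unfold cubeSites
    rw [Fintype.card_piFinset]
    have h : ∀ i : Fin 4, (Finset.Ico (c i) (c i + (2 * b + 1 : ℕ))).card = 2 * b + 1 := fun i => by
      rw [Int.card_Ico, add_sub_cancel_left, Int.toNat_natCast]
    simp_rw [h]
    rw [Finset.prod_const, Finset.card_univ, Fintype.card_fin]
  -- a geometric threshold
  set K : ℝ := 2 * ((2 * b + 1 : ℕ) : ℝ) ^ 4 * 4 with hK
  have hK0 : 0 < K := by rw [hK]; positivity
  obtain ⟨n₀, hn₀⟩ := exists_pow_lt_of_lt_one (div_pos hη hK0) (by norm_num : (1 / 2 : ℝ) < 1)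
  refine ⟨2 * (n₀ + 2 * b + 2) + 2, fun L hL β hβ F hFm hF1 hFS => ?_⟩
  have hh : n₀ + 2 * b + 2 ≤ (2 * L + 1) / 4 := by omega
  have hΔ : ∀ z ∈ cubeSites (fun j => (![(((2 * L + 1) / 4 : ℕ) : ℤ), 0, 0, 0] : Fin 4 → ℤ) j - b) (2 * b + 1) ×ˢ
      (Finset.univ : Finset (Fin 4)), ∀ j, |z.1 j - (![(((2 * L + 1) / 4 : ℕ) : ℤ), 0, 0, 0] : Fin 4 → ℤ) j| ≤ b := by
    intro z hz j
    rw [Finset.mem_product, mem_cubeSites_iff] at hz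
    have := hz.1 j
    rw [abs_le]
    simp only [Nat.cast_add, Nat.cast_mul, Nat.cast_ofNat, Nat.cast_one] at this
    constructor <;> linarith [this.1, this.2]
  have key := abs_mirror_cov_le_antipodal G r hβ L b (by omega) hFm hF1 hFS hΔ
  rw [hcard] at key
  refine (le_abs_self _).trans (key.trans ?_)
  have hpow : (1 / 2 : ℝ) ^ ((2 * L + 1) / 4 - 2 * b - 1) ≤ (1 / 2 : ℝ) ^ n₀ :=
    pow_le_pow_of_le_one (by norm_num) (by norm_num) (by omega)
  calc (1 : ℝ) * (2 * 1 * (((2 * b + 1) ^ 4 * 4 : ℕ) : ℝ) * (1 / 2 : ℝ) ^ ((2 * L + 1) / 4 - 2 * b - 1))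
      = K * (1 / 2 : ℝ) ^ ((2 * L + 1) / 4 - 2 * b - 1) := by rw [hK]; push_cast; ring
    _ ≤ K * (1 / 2 : ℝ) ^ n₀ := mul_le_mul_of_nonneg_left hpow hK0.le
    _ ≤ K * (η / K) := mul_le_mul_of_nonneg_left hn₀.le hK0.le
    _ = η := by field_simp


end Summit.QuantumFields.YangMills.Theorems.AntipodalMixingStrongCoupling

end
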